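import Summits.BirchSwinnertonDyer.BirchSwinnertonDyer.Theorems.ByReductionTypeAtTwoOrdKatoHalfAtTwoIsoKerCyclotomicTransposition
import Literature.NumberTheory.GaloisRepresentations.CyclotomicLevels
import HarnessLib

/-!
# Route ByReductionTypeAtTwo, crux `OrdKatoHalfAtTwoIso` (stmt-BirchSwinnertonDyer-19573), line `steinberg-fibre-at-two`
# (skeleton v11), stub `stub_coreA_posDisc : CoreTheoremAPosDiscTwo` (child 23967) — plan item (P3a′): Steinberg–Sah on `E[2]`
# (untwisted) relative to the DEEPER subgroup `ker ρ̄₂ ⊓ ker κ ⊓ Gal(ℚ̄/ℚ(μ_m))`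

Seat `cruxlead-stmt-BirchSwinnertonDyer-19573-g5` (LEAD PROVER, MODE LINE; HOME `run/shared/lean/pub/bsd-2adic/`; `--supports`
stmt-BirchSwinnertonDyer-19573 as helper). THEOREMS ONLY; nothing asserted; BSD is not proved by any of this; the crux and the stub are
NOT proved here. Companion of `…SahDeeper.lean` (the twisted `𝒯_J(E)` forms): the `E[2]`-level vanishing form used by the
`φ₀`-producer of the sign-free Chebotarev step (…ChebotarevTranspositionSignFree §1), with the vanishing hypothesis on the deeper
subgroup `ker ρ̄_{E,2} ⊓ ker κ ⊓ rootsOfUnityFixer ℚ m` — so that H-C⁺ (brief P3b) can run inside `Gal(ℚ̄/ℚ(μ_4))` and deliver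
Kolyvagin primes `q ≡ 1 (mod 4)`. Verbatim w2's `torsion_two_oneCocycleClass_eq_zero_of_forall_mem_eq_zero_of_noFixedPoint`
(p681344) with the one new conjunct in the centrality witness (trivial mod-`m` cyclotomic character of a commutator).

References: C.-H. Sah, *J. Algebra* (1968) Prop. 2.7 (b) [Sah1968]; J.-P. Serre, Invent. Math. 15 (1972) §2.6 [Serre1972]; tree
`…KerCyclotomicTransposition.lean` (parent proof, w2), `…SahRelNormal.lean` (engine), `CyclotomicLevels.lean` (`rootsOfUnityFixer_eq_ker`).
-/

set_option autoImplicit false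
set_option linter.dupNamespace false

noncomputable section

open Field WeierstrassCurve Function
open Literature.NumberTheory.EllipticCurves Literature.NumberTheory.GaloisRepresentations
open Literature.NumberTheory.EllipticCurves.DokchitserDokchitser2012
open Summit.BirchSwinnertonDyer.BirchSwinnertonDyer.Rank1Residual

-- D-0017: single-problem summit, so `Summit.BirchSwinnertonDyer.BirchSwinnertonDyer.…` repeats a namespace BY DESIGN.
namespace Summit.BirchSwinnertonDyer.BirchSwinnertonDyer.Theorems.SteinbergFibreAtTwo

section SahDeeperTorsion

variable (W : WeierstrassCurve ℚ) [W.IsElliptic] (κ : ZpExtension ℚ 2)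

/-- **Steinberg–Sah for `E[2]`, vanishing form, DEEPER subgroup**: given `σ₀ ∈ ker κ` without non-zero fixed point on `E[2]`, a
continuous 1-cocycle of `Γ_ℚ` in `E[2]` vanishing on `ker ρ̄_{E,2} ⊓ ker κ ⊓ rootsOfUnityFixer ℚ m` has zero class (engine `SahRelNormal`,
`H = ker(sgn ∘ permGal)`, `z = σ₀`; the witness `(hσ₀)⁻¹(σ₀h)` has trivial mod-`m` cyclotomic character).
[cite: Sah1968, Prop. 2.7 (b) and its proof, p. 60] [cite: Serre1972, §2.6] -/
theorem torsion_two_oneCocycleClass_eq_zero_of_forall_mem_inf_rootsOfUnityFixer_eq_zero_of_noFixedPoint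
    (m : ℕ) [NeZero m] {σ₀ : absoluteGaloisGroup ℚ}
    (hκ : σ₀ ∈ κ.kerSubgroup) (hσ₀ : ∀ P : geomTorsion W 2, P ≠ 0 → σ₀ • P ≠ P)
    (δ : contOneCocycles (W.torsionGaloisModule (2 : ℤ)).toTopRep)
    (hN : ∀ ν ∈ (galoisRepTorsion W 2).ker ⊓ κ.kerSubgroup ⊓ rootsOfUnityFixer ℚ m, δ.1 ν = 0) :
    oneCocycleClass _ δ = 0 := by
  have h2Q : (2 : ℚ) ≠ 0 := two_ne_zero
  -- `H = ker (sgn ∘ permGal)`, a normal subgroup containing `N` and the 3-cycle `σ₀`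
  let πG : absoluteGaloisGroup ℚ →* Equiv.Perm (Fin 3) :=
    { toFun := permGal W h2Q, map_one' := permGal_one W h2Q, map_mul' := permGal_mul W h2Q }
  let H : Subgroup (absoluteGaloisGroup ℚ) := (Equiv.Perm.sign.comp πG).ker
  have hHmem : ∀ g, g ∈ H ↔ Equiv.Perm.sign (permGal W h2Q g) = 1 := fun g => by
    change (Equiv.Perm.sign.comp πG) g = 1 ↔ _
    rfl
  have hHnormal : H.Normal := MonoidHom.normal_ker _
  have hσ₀T : ∀ i, permGal W h2Q σ₀ i ≠ i := by
    intro i hi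
    have hT : σ₀ • T W h2Q i = T W h2Q i := by rw [← T_permGal, hi]
    exact hσ₀ (T W h2Q i) (fun h0 => coe_T_ne_zero W h2Q i (by rw [h0]; rfl)) hT
  have hσ₀H : σ₀ ∈ H := (hHmem σ₀).mpr (perm_fin_three_sign_eq_one_of_forall_ne _ hσ₀T)
  have hNH : (galoisRepTorsion W 2).ker ⊓ κ.kerSubgroup ⊓ rootsOfUnityFixer ℚ m ≤ H := by
    intro ν hν
    have hν1 : permGal W h2Q ν = 1 :=
      (forall_smul_eq_iff_permGal_eq_one W ν).mp
        ((mem_ker_galoisRepTorsion_two_iff W ν).mp (Subgroup.mem_inf.mp (Subgroup.mem_inf.mp hν).1).1)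
    rw [hHmem, hν1, map_one]
  -- `σ₀` commutes with `H` on `E[2]`, hence is central in `H` modulo `N`
  have hcommE : ∀ h ∈ H, ∀ P : geomTorsion W 2, σ₀ • h • P = h • σ₀ • P := by
    intro h hh P
    have hperm : permGal W h2Q (σ₀ * h) = permGal W h2Q (h * σ₀) := by
      rw [permGal_mul, permGal_mul]
      exact perm_fin_three_comm_of_sign_eq_one _ _ ((hHmem σ₀).mp hσ₀H) ((hHmem h).mp hh)
    rw [← mul_smul, ← mul_smul]
    exact smul_eq_smul_of_permGal_eq W hperm P
  have hz : ∀ h ∈ H, ∃ n ∈ (galoisRepTorsion W 2).ker ⊓ κ.kerSubgroup ⊓ rootsOfUnityFixer ℚ m, σ₀ * h = h * σ₀ * n := by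
    intro h hh
    refine ⟨(h * σ₀)⁻¹ * (σ₀ * h), Subgroup.mem_inf.mpr ⟨Subgroup.mem_inf.mpr ⟨?_, ?_⟩, ?_⟩, by group⟩
    · rw [mem_ker_galoisRepTorsion_two_iff]
      intro P
      rw [mul_smul, mul_smul, hcommE h hh P, ← mul_smul h σ₀, inv_smul_smul]
    · rw [ZpExtension.mem_kerSubgroup] at hκ ⊢
      rw [map_mul, map_inv, map_mul, map_mul, hκ, mul_one, one_mul, inv_mul_cancel]
    · -- a commutator fixes `μ_m`: the mod-`m` cyclotomic character is valued in a commutative group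
      haveI : NeZero (m : ℚ) := NeZero.charZero
      rw [rootsOfUnityFixer_eq_ker, MonoidHom.mem_ker, map_mul, map_inv, map_mul, map_mul,
        mul_comm (modNCyclotomicCharacter ℚ m σ₀) (modNCyclotomicCharacter ℚ m h), inv_mul_cancel]
  have hcomm : ∀ h ∈ H, ∀ x : (W.torsionGaloisModule (2 : ℤ)).toTopRep,
      (W.torsionGaloisModule (2 : ℤ)).toTopRep.ρ σ₀ ((W.torsionGaloisModule (2 : ℤ)).toTopRep.ρ h x) =
        (W.torsionGaloisModule (2 : ℤ)).toTopRep.ρ h ((W.torsionGaloisModule (2 : ℤ)).toTopRep.ρ σ₀ x) :=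
    fun h hh x => hcommE h hh x
  -- `σ₀ − 1` is bijective on the finite `E[2]` (no non-zero fixed point)
  haveI : Finite (geomTorsion W (2 : ℤ)) :=
    WeierstrassCurve.finite_torsionPoints_holds W (AlgebraicClosure ℚ) (by norm_num)
  have hbij : Bijective fun x : (W.torsionGaloisModule (2 : ℤ)).toTopRep =>
      (W.torsionGaloisModule (2 : ℤ)).toTopRep.ρ σ₀ x - x := by
    have hinj : Injective fun x : geomTorsion W (2 : ℤ) => σ₀ • x - x := by
      intro x y hxy
      by_contra hne
      refine hσ₀ (x - y) (sub_ne_zero.mpr hne) ?_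
      rw [smul_sub]
      exact sub_eq_sub_iff_sub_eq_sub.mp hxy
    exact ⟨hinj, Finite.injective_iff_surjective.mp hinj⟩
  exact SahRelNormal.oneCocycleClass_eq_zero_of_forall_mem_eq_zero_of_normal δ _ H hHnormal hNH hN hσ₀H hz
    hcomm hbij

end SahDeeperTorsion

end Summit.BirchSwinnertonDyer.BirchSwinnertonDyer.Theorems.SteinbergFibreAtTwo

end
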